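import Summits.MatrixMultiplication.OmegaCensus.ThreeSetLineModFourSliceParitySound
import HarnessLib

/-!
# `(4,8,10)@961`: killer `1` (`[28, 29, 30, 30]`) — block file `46` (2 blocks, ≈ 22 s of kernel time)

ω-census `pub-omega`, family (b3), seat pub-omega-group gen 42.  Framing: lottery ticket; floor = certified bounds/negative ranges.
VALUE: part of the finite half of the kernel route for the census cell `(4,8,10)@961` (bit-sliced mod-4 filter + parity-local
kill, `ThreeSetLineModFourSlice*`; the «100 % kill» of the filter is a completeness datum measured on samples, NOT a correctness
input: every datum is decided by the kernel); NOT progress on ω.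
-/

set_option Elab.async false

namespace Summit.MatrixMultiplication.OmegaCensus

namespace Z31M4810

/-- Killer `1`, TAIL block `pre = [2]`, first free entry ≥ 1, free part `compsLit 30 5` (278256 data); 0 declared survivor(s). [folklore] -/
theorem t1_176 : ∀ Fl ∈ (ZpZpDomino.compsLit 30 5).map (fun l => ([2] : List ℕ) ++ LineMod.bumpHead 1 l), ∀ (G : ZMod 31 → ℕ) (s : ZMod 31), (∀ u, G u ≤ 10) →
    ¬ ∀ τ : ZMod 31, (∑ u : ZMod 31, lineMat3 (vecFn [0,0,0,0,0,0,0,0,0,0,0,0,0,0,0,0,0,0,0,0,0,0,0,0,0,0,0,0,1,1,2]) (vecFn Fl) τ u * G u) + (if s = τ then 1 else 0) = 31 :=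
  haveI : Fact (Nat.Prime 31) := ⟨by decide⟩
  LineMod.blockChkG_sound (by decide +kernel : LineMod.blockChkG 31 31 8 10 [0,0,0,0,0,0,0,0,0,0,0,0,0,0,0,0,0,0,0,0,0,0,0,0,0,0,0,0,1,1,2] [2] 30 5 1 [false, true, true, false, true, false, true] 5 5 [1,3,5] []
    0 0 0 0 0 [] [] [] [] = true)

/-- Killer `1`, TAIL block `pre = []`, first free entry ≥ 3, free part `compsLit 31 5` (324632 data); 0 declared survivor(s). [folklore] -/
theorem t1_177 : ∀ Fl ∈ (ZpZpDomino.compsLit 31 5).map (fun l => ([] : List ℕ) ++ LineMod.bumpHead 3 l), ∀ (G : ZMod 31 → ℕ) (s : ZMod 31), (∀ u, G u ≤ 10) →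
    ¬ ∀ τ : ZMod 31, (∑ u : ZMod 31, lineMat3 (vecFn [0,0,0,0,0,0,0,0,0,0,0,0,0,0,0,0,0,0,0,0,0,0,0,0,0,0,0,0,1,1,2]) (vecFn Fl) τ u * G u) + (if s = τ then 1 else 0) = 31 :=
  haveI : Fact (Nat.Prime 31) := ⟨by decide⟩
  LineMod.blockChkG_sound (by decide +kernel : LineMod.blockChkG 31 31 8 10 [0,0,0,0,0,0,0,0,0,0,0,0,0,0,0,0,0,0,0,0,0,0,0,0,0,0,0,0,1,1,2] [] 31 5 3 [false, true, true, false, true, false, true] 5 5 [1,3,5] []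
    0 0 0 0 0 [] [] [] [] = true)

end Z31M4810

end Summit.MatrixMultiplication.OmegaCensus
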